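import Summits.HodgeConjecture.HodgeConjecture.Theorems.MarkmanPartnerTransportPartnerExistenceComplexify
import Summits.HodgeConjecture.HodgeConjecture.Theorems.MarkmanPartnerTransportPartnerExistenceSignatureComplement
import Summits.HodgeConjecture.HodgeConjecture.Theorems.MarkmanPartnerTransportPartnerExistenceLatticeSignature

/-!
# Route MarkmanPartnerTransport · support `PartnerExistence` (stmt-HodgeConjecture-19655) —
# an integral vector of positive square orthogonal to the transported transcendental space

For a marked smooth projective fourfold `(X, φ, P, z)` and a `ℚ`-linear `F : ℚ²³ → ℚ²²` which is a
`q`-isometry on the rational transcendental space `T_ℚ` (Hasse–Minkowski step), **there is a lattice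
vector `u ∈ Λ_{K3} = ℤ²²` with `(u . F(T_ℚ)) = 0` and `(u.u) > 0`** — the projectivity input
`∃ v, (v.x) = 0 ∧ (v.v) > 0` of `Surfaces.Huybrechts_K3_periodSurjective_projective` for the transported
period `x = F_ℂ z` (`k3Form_intCast_transportedPeriod`).  Proof: over `ℝ`, `A = F_ℝ(T_ℚ ⊗ ℝ)` with
`x₁ = F_ℝ(Re z)`, `x₂ = F_ℝ(Im z)` satisfies the Hodge-index hypothesis of
`PartnerExistenceSignature.exists_pos_mem_orthogonal` (transport of
`qR_self_neg_of_mem_span_ratTransc` by the isometry), giving a REAL positive vector in `A^⊥`;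
`A^⊥ = (F(T_ℚ))^⊥ ⊗ ℝ` (orthogonals commute with `⊗ ℝ`, dimension count); a rational vector of positive
square exists nearby (density of `ℚ^k` in `ℝ^k`, continuity of the form); clear denominators
(`Surfaces.latticeMultiple`).

* `finrank_span_realCast`, `orthogonal_span_realCast` — `⊗ ℝ` of rational subspaces of `Λ_ℚ`;
* `exists_rat_pos_of_real_pos` — density step;
* `exists_pos_real_orthogonal`, `exists_pos_rat_orthogonal`, `exists_pos_int_orthogonal`;
* `k3Form_intCast_transportedPeriod` — `(u . x) = 0` for the transported period.

No definition, no sorry, no named fact. Prover seat hodge-nonav-19652-p1 (gen 5), `--supports stmt-HodgeConjecture-19655`.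

References: D. Huybrechts, *Lectures on K3 Surfaces*, Ch. 1 §3 (projectivity criterion), Ch. 6 Prop. 1.2
and Rem. 3.3; D. Morrison, Invent. Math. 75 (1984) §1–2.
-/

noncomputable section

set_option linter.dupNamespace false

open scoped Matrix
open Module CategoryTheory
open Literature.AlgebraicTopology.SingularHomology Literature.Geometry.Kaehler
open Literature.AlgebraicGeometry Literature.AlgebraicGeometry.Motives Literature.AlgebraicGeometry.HodgeTheory
open Literature.AlgebraicGeometry.Hyperkaehler Literature.AlgebraicGeometry.Surfaces
open Summit.HodgeConjecture.HodgeConjecture.Theorems.NikulinTwinTransport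
open Summit.HodgeConjecture.HodgeConjecture.Theorems.AnchorExistenceCMFloor
open Summit.HodgeConjecture.HodgeConjecture.Theorems.MarkmanPartnerTransport.BBFPositivity
open Summit.HodgeConjecture.HodgeConjecture.Theorems.MarkmanPartnerTransport.PartnerExistenceSignature

namespace Summit.HodgeConjecture.HodgeConjecture.Theorems.MarkmanPartnerTransport.PartnerLattice

variable {X : SchemeOver ℂ}

/-- `MarkedK3Sq[X, φ, P, z]`: VERBATIM the `let MarkedK3Sq := …` binder of the route declarations of
MarkmanPartnerTransport (clauses (m1)–(m6)). Local notation only. -/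
local notation3 (prettyPrint := false) "MarkedK3Sq[" X ", " φ ", " P ", " z "]" =>
  (((IsIntegralClass P ∧ ∀ Q : complexBetti X (2 * 4), IsIntegralClass Q → ∃ n : ℤ, Q = n • P) ∧
    (∀ c : complexBetti X 2, IsIntegralClass c ↔ ∃ v : K3HilbertIndex → ℤ, φ c = fun i => (v i : ℂ)) ∧
    (∀ a : complexBetti X 2, cupPowTwo a 4 = ((3 : ℂ) * (k3HilbertForm 2 (φ a) (φ a)) ^ 2) • P) ∧
    (IsOfHodgeType 4 X 2 2 0 (LinearEquiv.symm φ z) ∧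
      ∀ τ : complexBetti X 2, IsOfHodgeType 4 X 2 2 0 τ → ∃ t : ℂ, τ = t • LinearEquiv.symm φ z) ∧
    (∀ c : complexBetti X 2, IsOfHodgeType 4 X 2 1 1 c ↔
      (k3HilbertForm 2 (φ c) z = 0 ∧ k3HilbertForm 2 (φ c) (star z) = 0)) ∧
    (k3HilbertForm 2 z z = 0 ∧ 0 < (k3HilbertForm 2 (star z) z).re)))

/-- `qQ` = the rational Beauville–Bogomolov form of `K3^{[2]}`-type on `ℚ²³`. Local notation only. -/
local notation3 (prettyPrint := false) "qQ" => Matrix.toBilin' (Matrix.map (k3HilbertGram 2) (Int.cast : ℤ → ℚ))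

/-- `qR` = the real Beauville–Bogomolov form of `K3^{[2]}`-type on `ℝ²³`. Local notation only. -/
local notation3 (prettyPrint := false) "qR" => Matrix.toBilin' (Matrix.map (k3HilbertGram 2) (Int.cast : ℤ → ℝ))

/-- `cx[F]` = the complexification of a `ℚ`-linear `F : ℚ²³ → ℚ²²`. Local notation only. -/
local notation3 (prettyPrint := false) "cx[" F "]" =>
  Matrix.toLin' (Matrix.map (LinearMap.toMatrix' (R := ℚ) F) (Rat.cast : ℚ → ℂ))

/-- `rl[F]` = the realification of a `ℚ`-linear `F : ℚ²³ → ℚ²²`. Local notation only. -/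
local notation3 (prettyPrint := false) "rl[" F "]" =>
  Matrix.toLin' (Matrix.map (LinearMap.toMatrix' (R := ℚ) F) (Rat.cast : ℚ → ℝ))

/-! ### `⊗ ℝ` of rational subspaces of `Λ_ℚ` -/

/-- **`dim_ℝ (R ⊗ ℝ) = dim_ℚ R`** for a `ℚ`-subspace `R ⊆ ℚ^ι`. [folklore] -/
theorem finrank_span_realCast {ι : Type*} [Fintype ι] (R : Submodule ℚ (ι → ℚ)) :
    finrank ℝ (Submodule.span ℝ
      ((fun a : ι → ℚ => fun i => (a i : ℝ)) '' (R : Set (ι → ℚ)))) = finrank ℚ R := by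
  -- the proof of `finrank_span_ratCast` with `ℝ` for `ℂ`
  classical
  let b := Module.finBasis ℚ R
  let f : Fin (finrank ℚ R) → ι → ℝ := fun k i => (((b k : R) : ι → ℚ) i : ℝ)
  have hli : LinearIndependent ℝ f := by
    have hb : LinearIndependent ℚ fun k => ((b k : R) : ι → ℚ) :=
      b.linearIndependent.map' R.subtype (Submodule.ker_subtype R)
    have h := (linearIndependent_algebraMap_comp_iff (S := ℝ)).2 hb
    have hf : f = fun k => ⇑(algebraMap ℚ ℝ) ∘ ((b k : R) : ι → ℚ) := by
      funext k i
      simp only [f, Function.comp_apply, eq_ratCast]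
    rw [hf]
    exact h
  have hspan : Submodule.span ℝ ((fun a : ι → ℚ => fun i => (a i : ℝ)) '' (R : Set (ι → ℚ))) =
      Submodule.span ℝ (Set.range f) := by
    apply le_antisymm
    · refine Submodule.span_le.2 ?_
      rintro _ ⟨a, ha, rfl⟩
      have ha' : (⟨a, ha⟩ : R) = ∑ k, b.repr ⟨a, ha⟩ k • b k := (b.sum_repr _).symm
      have hc : (fun i => (a i : ℝ)) = ∑ k, (b.repr ⟨a, ha⟩ k : ℝ) • f k := by
        have h2 := congrArg (fun r : R => fun i => (((r : R) : ι → ℚ) i : ℝ)) ha'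
        simp only at h2
        rw [h2]
        funext i
        simp only [f, Submodule.coe_sum, Submodule.coe_smul, Finset.sum_apply, Pi.smul_apply,
          Rat.cast_sum, Rat.cast_mul, smul_eq_mul]
      show (fun i => (a i : ℝ)) ∈ Submodule.span ℝ (Set.range f)
      rw [hc]
      exact Submodule.sum_mem _ fun k _ => Submodule.smul_mem _ _ (Submodule.subset_span ⟨k, rfl⟩)
    · refine Submodule.span_mono ?_
      rintro _ ⟨k, rfl⟩
      exact ⟨((b k : R) : ι → ℚ), (b k).2, rfl⟩
  rw [hspan, finrank_span_eq_card hli, Fintype.card_fin]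

/-- **Orthogonals commute with `⊗ ℝ` in `Λ_ℚ`**: `(W ⊗ ℝ)^⊥ = W^⊥ ⊗ ℝ` for the K3 form (inclusion and the
dimension count `22 − dim W`). [cite: Huybrechts2016K3, Ch. 3 §2] -/
theorem orthogonal_span_realCast (W : Submodule ℚ (K3Index → ℚ)) :
    k3FormR.orthogonal (Submodule.span ℝ ((fun a : K3Index → ℚ => fun i => (a i : ℝ)) '' (W : Set (K3Index → ℚ)))) =
      Submodule.span ℝ ((fun a : K3Index → ℚ => fun i => (a i : ℝ)) ''
        (k3FormRat.orthogonal W : Set (K3Index → ℚ))) := by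
  symm
  apply Submodule.eq_of_le_of_finrank_le
  · refine Submodule.span_le.2 ?_
    rintro _ ⟨m, hm, rfl⟩
    rw [SetLike.mem_coe, LinearMap.BilinForm.mem_orthogonal_iff]
    intro n hn
    show k3FormR n (fun i => (m i : ℝ)) = 0
    rw [k3FormR_comm]
    have hle : Submodule.span ℝ ((fun a : K3Index → ℚ => fun i => (a i : ℝ)) '' (W : Set (K3Index → ℚ))) ≤
        LinearMap.ker (k3FormR (fun i => (m i : ℝ))) := by
      refine Submodule.span_le.2 ?_
      rintro _ ⟨w, hw, rfl⟩
      rw [SetLike.mem_coe, LinearMap.mem_ker]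
      show k3FormR (fun i => (m i : ℝ)) (fun i => (w i : ℝ)) = 0
      rw [← k3FormRat_realCast, k3FormRat_isSymm.eq, (LinearMap.BilinForm.mem_orthogonal_iff.1 hm) w hw,
        Rat.cast_zero]
    exact hle hn
  · rw [LinearMap.BilinForm.finrank_orthogonal k3FormR_nondegenerate, finrank_span_realCast,
      finrank_span_realCast, LinearMap.BilinForm.finrank_orthogonal k3FormRat_nondegenerate, finrank_k3Real,
      finrank_k3Rat]

/-! ### Density: a rational vector of positive square near a real one -/

/-- **If `W ⊗ ℝ` contains a vector of positive square, so does `W`** (`ℚ^k` is dense in `ℝ^k` and the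
form is continuous). [folklore] -/
theorem exists_rat_pos_of_real_pos (W : Submodule ℚ (K3Index → ℚ)) {m : K3Index → ℝ}
    (hm : m ∈ Submodule.span ℝ ((fun a : K3Index → ℚ => fun i => (a i : ℝ)) '' (W : Set (K3Index → ℚ))))
    (hpos : 0 < k3FormR m m) : ∃ m' ∈ W, 0 < k3FormRat m' m' := by
  classical
  let b := Module.finBasis ℚ W
  let cb : Fin (finrank ℚ W) → K3Index → ℝ := fun j i => (((b j : W) : K3Index → ℚ) i : ℝ)
  have hle : Submodule.span ℝ ((fun a : K3Index → ℚ => fun i => (a i : ℝ)) '' (W : Set (K3Index → ℚ))) ≤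
      Submodule.span ℝ (Set.range cb) := by
    refine Submodule.span_le.2 ?_
    rintro _ ⟨a, ha, rfl⟩
    have ha' : (⟨a, ha⟩ : W) = ∑ j, b.repr ⟨a, ha⟩ j • b j := (b.sum_repr _).symm
    have hc : (fun i => (a i : ℝ)) = ∑ j, (b.repr ⟨a, ha⟩ j : ℝ) • cb j := by
      have h2 := congrArg (fun r : W => fun i => (((r : W) : K3Index → ℚ) i : ℝ)) ha'
      simp only at h2
      rw [h2]
      funext i
      simp only [cb, Submodule.coe_sum, Submodule.coe_smul, Finset.sum_apply, Pi.smul_apply,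
        Rat.cast_sum, Rat.cast_mul, smul_eq_mul]
    show (fun i => (a i : ℝ)) ∈ Submodule.span ℝ (Set.range cb)
    rw [hc]
    exact Submodule.sum_mem _ fun j _ => Submodule.smul_mem _ _ (Submodule.subset_span ⟨j, rfl⟩)
  obtain ⟨c₀, hc₀⟩ := (Submodule.mem_span_range_iff_exists_fun ℝ).1 (hle hm)
  -- the continuous function `c ↦ (L c . L c)`
  let L : (Fin (finrank ℚ W) → ℝ) → (K3Index → ℝ) := fun c => ∑ j, c j • cb j
  have hL : Continuous L := by
    refine continuous_finsetSum _ fun j _ => ?_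
    exact (continuous_apply j).smul continuous_const
  let g : (Fin (finrank ℚ W) → ℝ) → ℝ := fun c => k3FormR (L c) (L c)
  have hg : Continuous g := by
    have hq : Continuous fun u : K3Index → ℝ => k3FormR u u := by
      simp only [k3FormR_apply]
      refine continuous_finsetSum _ fun i _ => continuous_finsetSum _ fun j _ => ?_
      exact ((continuous_apply i).mul continuous_const).mul (continuous_apply j)
    exact hq.comp hL
  have hg₀ : 0 < g c₀ := by
    show 0 < k3FormR (L c₀) (L c₀)
    simp only [L]
    rw [hc₀]
    exact hpos
  have hev : ∀ᶠ c in nhds c₀, 0 < g c := (hg.tendsto c₀).eventually (eventually_gt_nhds hg₀)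
  obtain ⟨ε, hε, hball⟩ := Metric.eventually_nhds_iff.1 hev
  have hq : ∀ j, ∃ q : ℚ, dist (q : ℝ) (c₀ j) < ε := fun j => by
    obtain ⟨q, hq1, hq2⟩ := exists_rat_btwn (show c₀ j - ε < c₀ j + ε by linarith)
    refine ⟨q, ?_⟩
    rw [Real.dist_eq, abs_lt]
    constructor <;> linarith
  choose q hq using hq
  have hdist : dist (fun j => (q j : ℝ)) c₀ < ε := (dist_pi_lt_iff hε).2 hq
  have hpos' : 0 < g (fun j => (q j : ℝ)) := hball hdist
  refine ⟨∑ j, q j • ((b j : W) : K3Index → ℚ),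
    Submodule.sum_mem _ fun j _ => Submodule.smul_mem _ _ (b j).2, ?_⟩
  have hcast : (fun i => ((∑ j, q j • ((b j : W) : K3Index → ℚ)) i : ℝ)) = L (fun j => (q j : ℝ)) := by
    funext i
    simp only [L, cb, Finset.sum_apply, Pi.smul_apply, smul_eq_mul, Rat.cast_sum, Rat.cast_mul]
  have h := k3FormRat_realCast (∑ j, q j • ((b j : W) : K3Index → ℚ)) (∑ j, q j • ((b j : W) : K3Index → ℚ))
  rw [hcast] at h
  have h' : (0 : ℝ) < ((k3FormRat (∑ j, q j • ((b j : W) : K3Index → ℚ))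
      (∑ j, q j • ((b j : W) : K3Index → ℚ)) : ℚ) : ℝ) := by
    rw [h]
    exact hpos'
  exact_mod_cast h'

/-! ### The positive vector -/

section NS

variable {φ : complexBetti X 2 ≃ₗ[ℂ] (K3HilbertIndex → ℂ)} {P : complexBetti X (2 * 4)} {z : K3HilbertIndex → ℂ}
  {NQ : Submodule ℚ (K3HilbertIndex → ℚ)}

/-- **A real vector of positive square orthogonal to `F_ℝ(T_ℚ ⊗ ℝ)`**: the Hodge-index hypothesis of
`PartnerExistenceSignature.exists_pos_mem_orthogonal` for `A = F_ℝ(T_ℚ ⊗ ℝ)`, `x₁ = F_ℝ(Re z)`,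
`x₂ = F_ℝ(Im z)` is `qR_self_neg_of_mem_span_ratTransc` transported by the isometry `F`.
[cite: Huybrechts2016K3, Ch. 6 Prop. 1.2] [cite: Morrison1984, §1] -/
theorem exists_pos_real_orthogonal (hX : IsSmoothProjective 4 X) (hM : MarkedK3Sq[X, φ, P, z])
    (hNQ : ∀ v, v ∈ NQ ↔ φ.symm (fun i => (v i : ℂ)) ∈ algebraicClasses X 1)
    (F : (K3HilbertIndex → ℚ) →ₗ[ℚ] (K3Index → ℚ))
    (hF : ∀ t ∈ (qQ).orthogonal NQ, ∀ t' ∈ (qQ).orthogonal NQ, k3FormRat (F t) (F t') = qQ t t') :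
    ∃ m ∈ k3FormR.orthogonal ((Submodule.span ℝ ((fun a : K3HilbertIndex → ℚ => fun i => (a i : ℝ)) ''
        ((qQ).orthogonal NQ : Set (K3HilbertIndex → ℚ)))).map rl[F]), 0 < k3FormR m m := by
  obtain ⟨hre, him⟩ := re_im_period_mem hX hM hNQ
  refine exists_pos_mem_orthogonal _ (rl[F] (fun i => (z i).re)) (rl[F] (fun i => (z i).im)) ?_
  intro v hv h1 h2 hv0
  obtain ⟨w, hw, rfl⟩ := Submodule.mem_map.1 hv
  rw [k3FormR_rl_rl F _ hF hw hre] at h1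
  rw [k3FormR_rl_rl F _ hF hw him] at h2
  rw [k3FormR_rl_rl F _ hF hw hw]
  have hw0 : w ≠ 0 := by
    rintro rfl
    exact hv0 (map_zero _)
  exact qR_self_neg_of_mem_span_ratTransc hX hM hNQ hw h1 h2 hw0

/-- `F_ℝ(R ⊗ ℝ) = F(R) ⊗ ℝ`. [folklore] -/
theorem map_rl_span_realCast (F : (K3HilbertIndex → ℚ) →ₗ[ℚ] (K3Index → ℚ)) (R : Submodule ℚ (K3HilbertIndex → ℚ)) :
    (Submodule.span ℝ ((fun a : K3HilbertIndex → ℚ => fun i => (a i : ℝ)) '' (R : Set (K3HilbertIndex → ℚ)))).map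
        rl[F] =
      Submodule.span ℝ ((fun a : K3Index → ℚ => fun i => (a i : ℝ)) '' (R.map F : Set (K3Index → ℚ))) := by
  rw [Submodule.map_span]
  congr 1
  ext y
  constructor
  · rintro ⟨_, ⟨a, ha, rfl⟩, rfl⟩
    exact ⟨F a, Submodule.mem_map_of_mem ha, (rl_ratCast F a).symm⟩
  · rintro ⟨_, hb, rfl⟩
    obtain ⟨a, ha, rfl⟩ := Submodule.mem_map.1 hb
    exact ⟨fun i => (a i : ℝ), ⟨a, ha, rfl⟩, rl_ratCast F a⟩

/-- **A rational vector of positive square orthogonal to `F(T_ℚ)`.** [cite: Huybrechts2016K3, Ch. 6 Rem. 3.3]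
[cite: Morrison1984, §1–2] -/
theorem exists_pos_rat_orthogonal (hX : IsSmoothProjective 4 X) (hM : MarkedK3Sq[X, φ, P, z])
    (hNQ : ∀ v, v ∈ NQ ↔ φ.symm (fun i => (v i : ℂ)) ∈ algebraicClasses X 1)
    (F : (K3HilbertIndex → ℚ) →ₗ[ℚ] (K3Index → ℚ))
    (hF : ∀ t ∈ (qQ).orthogonal NQ, ∀ t' ∈ (qQ).orthogonal NQ, k3FormRat (F t) (F t') = qQ t t') :
    ∃ m' ∈ k3FormRat.orthogonal (((qQ).orthogonal NQ).map F), 0 < k3FormRat m' m' := by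
  obtain ⟨m, hm, hpos⟩ := exists_pos_real_orthogonal hX hM hNQ F hF
  rw [map_rl_span_realCast, orthogonal_span_realCast] at hm
  exact exists_rat_pos_of_real_pos _ hm hpos

/-- **An integral vector `u ∈ Λ_{K3}` of positive square orthogonal to `F(T_ℚ)`** (clear denominators).
[cite: Huybrechts2016K3, Ch. 1 §3 and Ch. 6 Rem. 3.3] -/
theorem exists_pos_int_orthogonal (hX : IsSmoothProjective 4 X) (hM : MarkedK3Sq[X, φ, P, z])
    (hNQ : ∀ v, v ∈ NQ ↔ φ.symm (fun i => (v i : ℂ)) ∈ algebraicClasses X 1)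
    (F : (K3HilbertIndex → ℚ) →ₗ[ℚ] (K3Index → ℚ))
    (hF : ∀ t ∈ (qQ).orthogonal NQ, ∀ t' ∈ (qQ).orthogonal NQ, k3FormRat (F t) (F t') = qQ t t') :
    ∃ u : K3Index → ℤ, (∀ t ∈ (qQ).orthogonal NQ, k3FormRat (fun i => (u i : ℚ)) (F t) = 0) ∧
      0 < ∑ i, ∑ j, u i * k3Gram i j * u j := by
  obtain ⟨m', hm', hpos⟩ := exists_pos_rat_orthogonal hX hM hNQ F hF
  refine ⟨latticeMultiple m', fun t ht => ?_, ?_⟩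
  · rw [intCast_latticeMultiple, map_smul, LinearMap.smul_apply, k3FormRat_isSymm.eq,
      (LinearMap.BilinForm.mem_orthogonal_iff.1 hm') (F t) (Submodule.mem_map_of_mem ht), smul_zero]
  · have h := k3FormRat_intCast (latticeMultiple m') (latticeMultiple m')
    rw [intCast_latticeMultiple] at h
    simp only [map_smul, LinearMap.smul_apply, smul_eq_mul] at h
    have hD : (0 : ℚ) < ((∏ j, (m' j).den : ℕ) : ℚ) := by
      have := prod_den_ne_zero_nat m'
      positivity
    have h' : (0 : ℚ) < ((∑ i, ∑ j, latticeMultiple m' i * k3Gram i j * latticeMultiple m' j : ℤ) : ℚ) := by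
      rw [← h]
      positivity
    exact_mod_cast h'

/-- `(u . F_ℂ y) = 0` for `y ∈ R ⊗ ℂ` and every rational `u ⊥ F(R)` (bilinear extension from the rational
generators). [folklore] -/
theorem k3Form_ratCast_cx_eq_zero (F : (K3HilbertIndex → ℚ) →ₗ[ℚ] (K3Index → ℚ))
    (R : Submodule ℚ (K3HilbertIndex → ℚ)) {u : K3Index → ℚ} (hu : ∀ t ∈ R, k3FormRat u (F t) = 0)
    {y : K3HilbertIndex → ℂ}
    (hy : y ∈ Submodule.span ℂ ((fun a : K3HilbertIndex → ℚ => fun i => (a i : ℂ)) '' (R : Set (K3HilbertIndex → ℚ)))) :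
    k3Form (fun i => (u i : ℂ)) (cx[F] y) = 0 := by
  induction hy using Submodule.span_induction with
  | mem x hx =>
    obtain ⟨t, ht, rfl⟩ := hx
    beta_reduce
    rw [cx_ratCast, k3Form_ratCast, hu t ht, Rat.cast_zero]
  | zero => rw [map_zero, k3Form_zero_right]
  | add x y _ _ hx hy => rw [map_add, k3Form_add_right, hx, hy, add_zero]
  | smul c x _ hx => rw [map_smul, k3Form_smul_right, hx, mul_zero]

/-- **`(u . x) = 0` for the transported period `x = F_ℂ z`** and every rational `u ⊥ F(T_ℚ)`
(`z ∈ T_ℚ ⊗ ℂ`). [cite: Huybrechts2016K3, Ch. 6 Rem. 3.3] -/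
theorem k3Form_ratCast_transportedPeriod (hX : IsSmoothProjective 4 X) (hM : MarkedK3Sq[X, φ, P, z])
    (hNQ : ∀ v, v ∈ NQ ↔ φ.symm (fun i => (v i : ℂ)) ∈ algebraicClasses X 1)
    (F : (K3HilbertIndex → ℚ) →ₗ[ℚ] (K3Index → ℚ)) {u : K3Index → ℚ}
    (hu : ∀ t ∈ (qQ).orthogonal NQ, k3FormRat u (F t) = 0) :
    k3Form (fun i => (u i : ℂ)) (cx[F] z) = 0 :=
  k3Form_ratCast_cx_eq_zero F _ hu (period_mem_span_ratTransc hX hM hNQ)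

end NS

end Summit.HodgeConjecture.HodgeConjecture.Theorems.MarkmanPartnerTransport.PartnerLattice

end
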